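import Literature.Analysis.SpecialFunctions.GegenbauerZonalPositivity
import Literature.Probability.LatticeModels.SphereReflectionPositivityProofs

/-!
# Neeb–Ólafsson 2014, Prop. 6.2 — proofs III: sufficiency in dimension `n ≥ 3`; the discharge

The last piece of the named fact `neebOlafsson2014_ballKernel_posSemidef_iff`
(K.-H. Neeb, G. Ólafsson, *Reflection positivity and conformal symmetry*, J. Funct. Anal. 266
(2014) 2174–2224 = arXiv:1206.2039, §6.2 Prop. 6.2): for `n ≥ 3` and `s ≥ n - 2` every finite
kernel matrix `((1 - 2⟨x_a, x_b⟩ + ‖x_a‖²‖x_b‖²)^{-s/2})_{a,b}`, `‖x_a‖ < 1`, is positive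
semidefinite (`ballKernel_posSemidef_dim_ge_three`), and the assembly
`neebOlafsson2014_ballKernel_posSemidef_iff_holds` (with `…Necessity` and `…Proofs`).

Neeb–Ólafsson transport the question to the half-space picture and read the answer off the
Wallach set of the light cone ([FK94]). Our proof is the classical harmonic-analysis one,
made elementary:

1. `(1 - 2p + q)^{-λ} = Σ_J P^λ_J(2p, q)` for `p² ≤ q < 1` (`λ = s/2 ≥ 0`; Gegenbauer generating
   function AAR (6.4.10), `Literature.Analysis.SpecialFunctions.hasSum_gegenbauerHom`), at
   `p = ⟨x_a, x_b⟩`, `q = ‖x_a‖²‖x_b‖²` (Cauchy–Schwarz gives `p² ≤ q`);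
2. Gegenbauer's connection formula with nonnegative coefficients from `λ` down to
   `μ = (n-2)/2 ≤ λ` (AAR Thm. 7.1.4'; `gegenbauerHom_eq_connSum`, `gegenbauerConn_nonneg`),
   the factors `q^i = (‖x_a‖²)^i (‖x_b‖²)^i` being absorbed into the coefficients;
3. positive-semidefiniteness of each zonal kernel `P^μ_d(2⟨x_a,x_b⟩, ‖x_a‖²‖x_b‖²)` on `ℝⁿ`
   (`sum_mul_gegenbauerHom_nonneg`, via the Fischer pairing — the addition theorem AAR 9.6.3);
4. closure of positive semidefiniteness under nonnegative combinations and entrywise limits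
   (`posSemidef_of_hasSum`).

## References

* K.-H. Neeb, G. Ólafsson, J. Funct. Anal. 266 (2014) 2174–2224, arXiv:1206.2039, §6.2
  Prop. 6.2. [`NeebOlafsson2014`]
* G. E. Andrews, R. Askey, R. Roy, *Special Functions*, CUP 1999, (6.4.10), Thm. 7.1.4',
  Thm. 9.6.3. [`AndrewsAskeyRoy1999`]
* I. J. Schoenberg, *Positive definite functions on spheres*, Duke Math. J. 9 (1942) 96–108
  (the sphere analogue). [folklore]
-/

noncomputable section

namespace Literature.Probability.LatticeModels

open Literature.Analysis.SpecialFunctions Finset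
open scoped RealInnerProductSpace



/-- PSD of each Gegenbauer component kernel `P^λ_J(2⟨x_a,x_b⟩, |x_a|²|x_b|²)` on `ℝⁿ` for
`λ ≥ μ = (n-2)/2 > 0` (Schoenberg-type transfer): connection formula with nonnegative
coefficients + zonal positivity. [cite: AndrewsAskeyRoy1999, Thm. 7.1.4' with Thm. 9.6.3] -/
theorem sum_mul_gegenbauerHom_nonneg_of_le {n : ℕ} {μ lam : ℝ} (hμ : (n : ℝ) = 2 * μ + 2)
    (hμpos : 0 < μ) (hlm : μ ≤ lam) (J : ℕ) {ι : Type*} [Fintype ι] (x : ι → Fin n → ℝ)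
    (c : ι → ℝ) :
    0 ≤ ∑ a, ∑ b, c a * c b *
      gegenbauerHom lam J (2 * ∑ k, x a k * x b k) ((∑ k, x a k ^ 2) * ∑ k, x b k ^ 2) := by
  simp_rw [gegenbauerHom_eq_connSum hμpos (A := ℝ), gegenbauerConnSum,
    Finset.mul_sum (s := antidiagonal J)]
  rw [Finset.sum_congr rfl fun a _ => Finset.sum_comm, Finset.sum_comm]
  refine Finset.sum_nonneg fun y _ => ?_
  obtain ⟨i, m⟩ := y
  simp only [smul_eq_mul]
  by_cases him : i ≤ m
  · obtain ⟨d, rfl⟩ := Nat.exists_eq_add_of_le him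
    have hE : ∀ a b : ι, gegenbauerE μ (((i + d : ℕ) : ℤ) - (i : ℕ) + 1) (2 * ∑ k, x a k * x b k)
        ((∑ k, x a k ^ 2) * ∑ k, x b k ^ 2) =
        gegenbauerHom μ d (2 * ∑ k, x a k * x b k) ((∑ k, x a k ^ 2) * ∑ k, x b k ^ 2) := by
      intro a b
      rw [show (((i + d : ℕ) : ℤ) - (i : ℕ) + 1) = ((d : ℕ) : ℤ) + 1 by push_cast; ring,
        gegenbauerE_natCast_succ]
    have hω : 0 ≤ gegenbauerConn lam μ i (i + d) := gegenbauerConn_nonneg hμpos hlm (by omega)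
    have key := sum_mul_gegenbauerHom_nonneg hμ hμpos d x (fun a => c a * (∑ k, x a k ^ 2) ^ i)
    have hfac : ∑ a, ∑ b, c a * c b * (gegenbauerConn lam μ i (i + d) *
        (((∑ k, x a k ^ 2) * ∑ k, x b k ^ 2) ^ i *
          gegenbauerE μ (((i + d : ℕ) : ℤ) - (i : ℕ) + 1) (2 * ∑ k, x a k * x b k)
            ((∑ k, x a k ^ 2) * ∑ k, x b k ^ 2))) =
        gegenbauerConn lam μ i (i + d) * ∑ a, ∑ b, c a * (∑ k, x a k ^ 2) ^ i *
          (c b * (∑ k, x b k ^ 2) ^ i) *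
          gegenbauerHom μ d (2 * ∑ k, x a k * x b k) ((∑ k, x a k ^ 2) * ∑ k, x b k ^ 2) := by
      rw [Finset.mul_sum]
      refine Finset.sum_congr rfl fun a _ => ?_
      rw [Finset.mul_sum]
      refine Finset.sum_congr rfl fun b _ => ?_
      rw [hE, mul_pow]
      ring
    rw [hfac]
    exact mul_nonneg hω key
  · have hle : ((m : ℕ) : ℤ) - (i : ℕ) + 1 ≤ 0 := by omega
    simp [gegenbauerE_of_nonpos μ hle]

/-- **Neeb–Ólafsson 2014, Prop. 6.2, sufficiency in dimension `n ≥ 3`**: for `s ≥ n - 2` every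
finite kernel matrix `((1 - 2⟨x_a,x_b⟩ + ‖x_a‖²‖x_b‖²)^{-s/2})_{a,b}`, `‖x_a‖ < 1`, is positive
semidefinite. Proof: Gegenbauer expansion `(1 - 2p + q)^{-λ} = Σ_J P^λ_J(2p, q)` (`λ = s/2`),
connection to `μ = (n-2)/2` with nonnegative coefficients, zonal positivity of each
`P^μ_d(2⟨x_a,x_b⟩, ‖x_a‖²‖x_b‖²)`, and closure of PSD under entrywise limits.
[cite: NeebOlafsson2014, Prop. 6.2 (§6.2, arXiv:1206.2039 p. 23), "if", n ≥ 3] -/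
theorem ballKernel_posSemidef_dim_ge_three {n : ℕ} (hn : 3 ≤ n) {s : ℝ} (hs : (n : ℝ) - 2 ≤ s)
    {ι : Type*} [Fintype ι] (x : ι → EuclideanSpace ℝ (Fin n)) (hx : ∀ a, ‖x a‖ < 1) :
    (Matrix.of fun a b : ι =>
      (1 - 2 * inner ℝ (x a) (x b) + ‖x a‖ ^ 2 * ‖x b‖ ^ 2) ^ (-s / 2)).PosSemidef := by
  set μ : ℝ := ((n : ℝ) - 2) / 2 with hμdef
  have hμ : (n : ℝ) = 2 * μ + 2 := by rw [hμdef]; ring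
  have hn' : (3 : ℝ) ≤ n := by exact_mod_cast hn
  have hμpos : 0 < μ := by rw [hμdef]; linarith
  have hlm : μ ≤ s / 2 := by rw [hμdef]; linarith
  have hlam : 0 ≤ s / 2 := hμpos.le.trans hlm
  -- coordinates
  set v : ι → Fin n → ℝ := fun a k => x a k with hv
  have hp : ∀ a b, inner ℝ (x a) (x b) = ∑ k, v a k * v b k := fun a b => by
    simp [PiLp.inner_apply, hv, mul_comm]
  have hq : ∀ a, ‖x a‖ ^ 2 = ∑ k, v a k ^ 2 := fun a => by
    rw [EuclideanSpace.real_norm_sq_eq]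
  -- the Gegenbauer expansion of each entry
  have hsum : ∀ a b, HasSum
      (fun J =>
        gegenbauerHom (s / 2) J (2 * ∑ k, v a k * v b k) ((∑ k, v a k ^ 2) * ∑ k, v b k ^ 2))
      ((1 - 2 * inner ℝ (x a) (x b) + ‖x a‖ ^ 2 * ‖x b‖ ^ 2) ^ (-s / 2)) := by
    intro a b
    have hcs : (∑ k, v a k * v b k) ^ 2 ≤ (∑ k, v a k ^ 2) * ∑ k, v b k ^ 2 := by
      rw [← hp, ← hq, ← hq]
      have h1 := abs_real_inner_le_norm (x a) (x b)
      have h2 : 0 ≤ ‖x a‖ * ‖x b‖ := by positivity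
      nlinarith [abs_nonneg (inner ℝ (x a) (x b)), sq_abs (inner ℝ (x a) (x b))]
    have hq1 : (∑ k, v a k ^ 2) * ∑ k, v b k ^ 2 < 1 := by
      rw [← hq, ← hq]
      have ha := hx a
      have hb := hx b
      have ha0 := norm_nonneg (x a)
      have hb0 := norm_nonneg (x b)
      have : ‖x a‖ * ‖x b‖ < 1 := by nlinarith
      nlinarith [mul_nonneg ha0 hb0]
    have h := hasSum_gegenbauerHom hlam hcs hq1
    rw [hp, hq, hq, show -s / 2 = -(s / 2) by ring]
    exact h
  refine posSemidef_of_hasSum (N := fun J => Matrix.of fun a b : ι =>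
    gegenbauerHom (s / 2) J (2 * ∑ k, v a k * v b k) ((∑ k, v a k ^ 2) * ∑ k, v b k ^ 2))
    (fun J => ?_) (fun a b => hsum a b)
  refine (posSemidef_iff_sum_mul_nonneg fun a b => ?_).2 fun c => ?_
  · simp only [Matrix.of_apply]
    rw [Finset.sum_congr rfl fun k _ => mul_comm (v a k) (v b k), mul_comm (∑ k, v a k ^ 2)]
  · simpa only [Matrix.of_apply] using sum_mul_gegenbauerHom_nonneg_of_le hμ hμpos hlm J v c

/-- **Neeb–Ólafsson 2014, Proposition 6.2 — the named fact
`neebOlafsson2014_ballKernel_posSemidef_iff`, DISCHARGED**: for `n ≥ 1`, `s ≥ 0`, the ball kernel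
`(1 - 2⟨x,y⟩ + ‖x‖²‖y‖²)^{-s/2}` is positive definite on the open unit ball of `ℝⁿ` iff `s = 0`
or `s ≥ n - 2` (necessity: `…Necessity`; sufficiency: `…Proofs` for `s = 0`, `n ≤ 2`, and
`ballKernel_posSemidef_dim_ge_three`). [cite: NeebOlafsson2014, Prop. 6.2 (§6.2,
arXiv:1206.2039 p. 23)] -/
theorem neebOlafsson2014_ballKernel_posSemidef_iff_holds :
    neebOlafsson2014_ballKernel_posSemidef_iff :=
  neebOlafsson2014_ballKernel_posSemidef_iff_of_dim_ge_three_sufficiency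
    fun _n hn _s hs _m x hx => ballKernel_posSemidef_dim_ge_three hn hs x hx

end Literature.Probability.LatticeModels

end
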